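import Summits.Langlands.Langlands.Theses.CyclicDeinductionCarving
import Summits.Langlands.Langlands.Theorems.QuadraticWindowHostInducedRepSignedTwistAux
import Literature.NumberTheory.GaloisRepresentations.FramedGaloisRepInduce
import Literature.NumberTheory.GaloisRepresentations.FramedGaloisRepSemisimplification
import Literature.NumberTheory.GaloisRepresentations.SorensenPatching
import Literature.NumberTheory.GaloisRepresentations.IntegralGaloisActionProofs
import Summits.Langlands.Langlands.Theorems.CyclicDeinductionClifford
import Literature.NumberTheory.GaloisRepresentations.AbsGaloisOuterConj
import Literature.NumberTheory.GaloisRepresentations.LAdicRepFrobenius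
import Literature.NumberTheory.GaloisRepresentations.ResidualPairIntegrality
import Literature.NumberTheory.GaloisRepresentations.FrobeniusDensityTheorem
import Literature.NumberTheory.GaloisRepresentations.ArtinRestriction
import Literature.NumberTheory.Automorphic.ChebotarevArtinRepHolds
import Literature.NumberTheory.Automorphic.HarrisLanTaylorThorneTwistedPairLimitProofs
import Literature.NumberTheory.GaloisRepresentations.TateTwistFrobeniusProofs
import Literature.NumberTheory.Automorphic.BaseChangeInductionAlong
import Literature.NumberTheory.Automorphic.AutomorphicRepsGLSatakeFlathProofs
import Literature.NumberTheory.Automorphic.SatakeParametersGL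
import Mathlib.RingTheory.RootsOfUnity.AlgebraicallyClosed
import HarnessLib

/-!
# `CyclicDeinductionCarving.InducedPreAvatar` — proof of the support item stmt-Langlands-27505

**Along a cyclic layer `K/K₀` of prime degree, a semisimple Satake avatar of the induced form
`Π = AI_{K/K₀}(π)` de-induces to a semisimple pre-avatar of `π`.**  For `K/K₀` cyclic Galois of
prime degree `p`, `π` cuspidal `L`-algebraic on `GL_m/K`, `Π` cuspidal `L`-algebraic on `GL_n/K₀`
with `Π` an a.e. automorphic induction of `π` (inlined: at almost every place `v` of `K₀`,
`∏_{a ∈ α_v}(X - a) = ∏_{w ∣ v} ∏_{b ∈ β_w}(X^{f(w|v)} - b)` for the Satake parameters), every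
semisimple `ι`-avatar `R : Γ_{K₀} → GL_n(ℚ̄_ℓ)` of `Π` yields a semisimple `r : Γ_K → GL_m(ℚ̄_ℓ)`,
unramified at the places above almost every `v`, whose Frobenius polynomials `Q_w` satisfy
`∏_{w ∣ v} Q_w(X^{f(w|v)}) = ∏_{w ∣ v} P_{π,w}(X^{f(w|v)})` — the honestly weakened avatar
(the per-place match `Q_w = P_{π,w}` is the separate, open, "σ-orbit separation").

## Proof (every input a theorem of the tree or proved here; no named fact is consumed)

1. *Frobenius data of `R`.*  At almost every `v`, `R` is unramified with Frobenius polynomial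
   `F_v = arithFrobPolyOfSatake ι q_v 1 α_v = ∏_{w ∣ v} G_w(X^{f(w|v)})`,
   `G_w = arithFrobPolyOfSatake ι q_w 1 β_w` (Satake–Frobenius compatibility of `R` with `Π`,
   uniqueness of Satake parameters `hasSatakeParamAt_unique_holds`, the inlined induction
   identity, and the host-polynomial identity `hostPoly_eq_arithFrobPolyOfSatake`).
2. *Twist stability `R ≅ R ⊗ χ`.*  Let `χ ≠ 1` be a character of `Γ_{K₀}` trivial on `res(Γ_K)`
   (a character of order `p` of `Gal(K/K₀)`, valued in the `p`-th roots of unity of `ℚ̄_ℓ`;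
   continuous because `res(Γ_K)` is open).  At a.e. `v` the inertia groups above `v` lie in
   `res(Γ_K)` (`eventually_forall_inertia_le_range_absGaloisRestrict`), so `R ⊗ χ` is unramified
   there, and for an arithmetic Frobenius `σ` at `𝔓 ∣ v` one has `χ(σ)^{f(w|v)} = 1` for every
   `w ∣ v` (`exists_frobenius_doubleCoset_data`: `σ^{f(w|v)}` is conjugate INTO `res(Γ_K)`).
   Hence `det(X - χ(σ)R(σ)) = F_v.scaleRoots χ(σ) = F_v` (`charpoly_smul_of_ne_zero`; the
   substitution `X ↦ χ(σ) X` fixes each factor `G_w(X^{f(w|v)})`, and a monic polynomial fixed by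
   `X ↦ cX` is fixed by `scaleRoots c`).  So `R` and `R ⊗ χ` — both semisimple — have the same
   Frobenius polynomials a.e., hence are isomorphic (`nonempty_equiv_of_hasFrobCharpolyAt_eventually`,
   Chebotarev + Brauer–Nesbitt, PROVED in the tree): `P R P⁻¹ = R ⊗ χ`.
3. *De-induction (Clifford, no irreducibility).*  A representation over an algebraically closed
   field with `P R P⁻¹ = R ⊗ χ`, `χ ≠ 1` of prime order `p` killing the index-`p` subgroup
   `res(Γ_K)`, has the characteristic polynomials of `Ind_{Γ_K}^{Γ_{K₀}} s` for a framed
   `s : Γ_K → GL_{m'}(ℚ̄_ℓ)`, `n = p m'`, with `s` trivial wherever `R|_{Γ_K}` is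
   (`Theorems/CyclicDeinductionClifford.lean`,
   `FramedRep.exists_charpoly_eq_charpoly_comp_indMatrix_of_conj_eq_twist'`: the space is
   the direct sum of the `R(g₀^i)`-translates of `U = ⊕_{ν ≠ 0} V(μ_ν)`, `V(μ)` the maximal
   generalised eigenspaces of `P`, `μ_ν` chosen `p`-th roots; this generalises the tree's
   irreducible case `CliffordInducedPrimeIndex`).
4. *Rank and packaging.*  `n = #α_v = deg ∏_{w ∣ v} ∏_{b ∈ β_w}(X^{f(w|v)} - b) = m · ∑_{w ∣ v} f(w|v)
   = m p` at one place `v` unramified in `K` (`natDegree_inducedSatakePolynomial`,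
   `finsum_inertiaDeg_eq_finrank`), so `m' = m`.  `s` is unramified at the places above a.e. `v`
   (it is trivial where `R|_{Γ_K}` is; `isUnramifiedAt_restrictField`), so it has Frobenius
   polynomials `Q_w` there, and `∏_{w ∣ v} Q_w(X^{f(w|v)}) = det(X - Ind(s)(σ_v)) = det(X - R(σ_v))
   = F_v = ∏_{w ∣ v} G_w(X^{f(w|v)})` (`hasFrobCharpolyAt_induce`).  Finally `r :=` the
   semisimplification of `s` (`FramedGaloisRep.exists_semisimplification`: same Frobenius
   polynomials, unramified wherever `s` is).

References: Arthur–Clozel, Ann. of Math. Stud. 120 (1989), Ch. 3 §6 (Lemma 6.3, Thm. 6.2);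
Clifford, Ann. of Math. 38 (1937), §§1–3; Serre, *Linear representations of finite groups*, §7.3,
§8.1; Neukirch, *Algebraic Number Theory*, VII (10.4); Deligne–Serre, ASENS 7 (1974), 6.12.
-/

noncomputable section

set_option linter.dupNamespace false

open scoped NumberField Classical Polynomial MatrixGroups Matrix
open Filter IsDedekindDomain Polynomial Field
open Literature.NumberTheory.Automorphic Literature.NumberTheory.GaloisRepresentations
open Summit.Langlands.Langlands.Theorems.HostInducedRep.GrsExplicitDescent (hostPoly
  hostPoly_eq_arithFrobPolyOfSatake setOf_asIdeal_under_eq)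

namespace Summit.Langlands.Langlands.Theorems

namespace CyclicDeinduction

/-! Clifford de-induction: `Summits.Langlands.Langlands.Theorems.CyclicDeinductionClifford` (same namespace). -/

/-! ### A character of order `p` of `Gal(K/K₀)` on `Γ_{K₀}` -/

section Character

open Field

/-- For a cyclic Galois extension `K/K₀` of number fields of prime degree `p` and an
algebraically closed field `A` of characteristic zero (with a ring topology), there is a
continuous character `χ : Γ_{K₀} → Aˣ`, trivial on `res(Γ_K)` and non-trivial: a generator of the
character group of `Gal(K/K₀) ≅ ℤ/p` with values in the `p`-th roots of unity of `A`, inflated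
to `Γ_{K₀}` (`absGaloisQuot`); continuity because `res(Γ_K)` is open
(`isOpenEmbedding_absGaloisRestrict`). [folklore] -/
theorem exists_layerCharacter (K₀ K : Type) [Field K₀] [NumberField K₀] [Field K] [NumberField K]
    [Algebra K₀ K] [IsGalois K₀ K] [IsCyclic (K ≃ₐ[K₀] K)] (hp : (Module.finrank K₀ K).Prime)
    (A : Type) [Field A] [TopologicalSpace A] [IsTopologicalRing A] [IsAlgClosed A] [CharZero A] :
    ∃ χ : absoluteGaloisGroup K₀ →ₜ* Aˣ,
      (∀ τ : absoluteGaloisGroup K, χ (absGaloisRestrict K₀ K τ) = 1) ∧ χ ≠ 1 := by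
  classical
  haveI : FiniteDimensional K₀ K := Module.Finite.of_restrictScalars_finite ℚ K₀ K
  -- a generator of `Gal(K/K₀)`, of order `p`
  obtain ⟨g₀, hg₀⟩ := IsCyclic.exists_generator (α := K ≃ₐ[K₀] K)
  have hord : orderOf g₀ = Module.finrank K₀ K := by
    rw [orderOf_eq_card_of_forall_mem_zpowers hg₀, IsGalois.card_aut_eq_finrank]
  -- a primitive `p`-th root of unity `ζ ∈ A`
  haveI : NeZero ((Module.finrank K₀ K : ℕ) : A) := ⟨Nat.cast_ne_zero.mpr hp.ne_zero⟩
  obtain ⟨ζ, hζ⟩ := HasEnoughRootsOfUnity.exists_primitiveRoot A (Module.finrank K₀ K)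
  have hζunit : IsUnit ζ := hζ.isUnit hp.ne_zero
  obtain ⟨ζu, hζu⟩ : ∃ ζu : Aˣ, (ζu : A) = ζ := hζunit
  have hζu' : IsPrimitiveRoot ζu (Module.finrank K₀ K) := by
    rw [← IsPrimitiveRoot.coe_units_iff, hζu]
    exact hζ
  have hdvd : orderOf ζu ∣ orderOf g₀ := by
    rw [hord, ← hζu'.eq_orderOf]
  -- the character of `Gal(K/K₀)` with `g₀ ↦ ζ`, inflated to `Γ_{K₀}`
  set χ₀ : (K ≃ₐ[K₀] K) →* Aˣ := monoidHomOfForallMemZpowers hg₀ hdvd with hχ₀def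
  have hχ₀ : χ₀ g₀ = ζu := monoidHomOfForallMemZpowers_apply_gen hg₀ hdvd
  set χ₁ : absoluteGaloisGroup K₀ →* Aˣ := χ₀.comp (absGaloisQuot K₀ K) with hχ₁def
  have hχ₁f : ∀ τ : absoluteGaloisGroup K, χ₁ (absGaloisRestrict K₀ K τ) = 1 := fun τ => by
    have hm : absGaloisQuot K₀ K (absGaloisRestrict K₀ K τ) = 1 :=
      (absGaloisQuot_eq_one_iff K₀ K _).2 ⟨τ, rfl⟩
    rw [hχ₁def, MonoidHom.comp_apply, hm, map_one]
  -- continuity: a homomorphism trivial on the open subgroup `res(Γ_K)`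
  have hcont : Continuous χ₁ := by
    apply continuous_of_continuousAt_one χ₁
    have h1 : ContinuousAt (χ₁ ∘ absGaloisRestrict K₀ K) 1 := by
      have h2 : (χ₁ : absoluteGaloisGroup K₀ → Aˣ) ∘ absGaloisRestrict K₀ K = fun _ => 1 :=
        funext hχ₁f
      rw [h2]
      exact continuousAt_const
    have h3 := (isOpenEmbedding_absGaloisRestrict K₀ K).continuousAt_iff.1 h1
    rwa [map_one] at h3
  let χ : absoluteGaloisGroup K₀ →ₜ* Aˣ := { toMonoidHom := χ₁, continuous_toFun := hcont }
  obtain ⟨τ₀, hτ₀⟩ := absGaloisQuot_surjective K₀ K g₀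
  refine ⟨χ, hχ₁f, fun h => ?_⟩
  have h1 : χ τ₀ = ζu := by
    change χ₀ (absGaloisQuot K₀ K τ₀) = ζu
    rw [hτ₀, hχ₀]
  have h2 : χ τ₀ = 1 := by
    rw [h]
    rfl
  exact hζu'.ne_one hp.one_lt (h1.symm.trans h2)

end Character

/-! ### Characteristic polynomials of twists -/

section Twist

/-- Composition with `C c * X` is injective on `R[X]` for a unit `c` — private same-file copy of the landed
`Literature.NumberTheory.GaloisRepresentations.comp_C_mul_X_injective` (CyclotomicPowerTwistProofs), kept private per the gate's dedup rule. [folklore] -/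
private theorem comp_C_mul_X_injective {R : Type*} [CommRing R] {c : R} (hc : IsUnit c) :
    Function.Injective fun q : R[X] => q.comp (C c * X) := by
  obtain ⟨u, rfl⟩ := hc
  intro q q' h
  have key : ∀ r : R[X], (r.comp (C (u : R) * X)).comp (C ((u⁻¹ : Rˣ) : R) * X) = r := fun r => by
    rw [comp_assoc, mul_comp, C_comp, X_comp, ← mul_assoc, ← C_mul, Units.mul_inv, C_1, one_mul,
      comp_X]
  have h' := congrArg (fun r : R[X] => r.comp (C ((u⁻¹ : Rˣ) : R) * X)) h
  simpa only [key] using h'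

/-- `charpoly (c • M) (cX) = c^n · charpoly M (X)` (`det (cX - cM) = c^n det (X - M)`).
[folklore] -/
theorem charpoly_smul_comp_C_mul_X {F : Type*} [Field F] {ι : Type*} [Fintype ι] [DecidableEq ι]
    (c : F) (M : Matrix ι ι F) :
    (c • M).charpoly.comp (C c * X) = C (c ^ Fintype.card ι) * M.charpoly := by
  have h1 : (c • M).charpoly.comp (C c * X) =
      ((Polynomial.compRingHom (C c * X)).mapMatrix (Matrix.charmatrix (c • M))).det := by
    rw [Matrix.charpoly, ← RingHom.map_det]; rfl
  have h2 : (Polynomial.compRingHom (C c * X)).mapMatrix (Matrix.charmatrix (c • M)) =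
      C c • Matrix.charmatrix M := by
    ext i j : 2
    by_cases hij : i = j
    · subst hij
      simp [Matrix.charmatrix_apply_eq, mul_sub]
    · simp [Matrix.charmatrix_apply_ne _ _ _ hij, smul_eq_mul]
  rw [h1, h2, Matrix.det_smul, Matrix.charpoly, ← C_pow]

/-- A monic polynomial over a field fixed by the substitution `X ↦ c X`, `c ≠ 0`, has
`c^{deg F} = 1` (compare leading coefficients). [folklore] -/
theorem pow_natDegree_eq_one_of_comp_C_mul_X {A : Type*} [Field A] {F : A[X]} (hF : F.Monic)
    {c : A} (hc : c ≠ 0) (h : F.comp (C c * X) = F) : c ^ F.natDegree = 1 := by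
  have hdeg : (C c * X).natDegree = 1 := natDegree_C_mul_X c hc
  have h1 := congrArg Polynomial.leadingCoeff h
  rw [leadingCoeff_comp (by rw [hdeg]; exact one_ne_zero), hF.leadingCoeff, one_mul,
    leadingCoeff_C_mul_X] at h1
  exact h1

/-- `∏_{w ∈ S} G_w(X^{f_w})` is fixed by `X ↦ c X` as soon as `c^{f_w} = 1` for all `w ∈ S`.
[folklore] -/
theorem finprod_comp_X_pow_comp_C_mul_X {A : Type*} [Field A] {ι : Type*} {S : Set ι}
    (hS : S.Finite) (G : ι → A[X]) (f : ι → ℕ) {c : A} (hc : ∀ w ∈ S, c ^ f w = 1) :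
    (∏ᶠ w ∈ S, (G w).comp (X ^ f w)).comp (C c * X) = ∏ᶠ w ∈ S, (G w).comp (X ^ f w) := by
  rw [finprod_mem_eq_finite_toFinset_prod _ hS, Polynomial.prod_comp]
  refine Finset.prod_congr rfl fun w hw => ?_
  rw [Polynomial.comp_assoc, X_pow_comp, mul_pow, ← C_pow, hc w (hS.mem_toFinset.mp hw), C_1,
    one_mul]

end Twist

end CyclicDeinduction

set_option maxHeartbeats 1600000 in
open CyclicDeinduction in
/-- **`CyclicDeinductionCarving.InducedPreAvatar` holds** (stmt-Langlands-27505): along a cyclic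
layer of prime degree, semisimple Satake avatars of `AI_{K/K₀}(π)` de-induce to semisimple
pre-avatars of `π` (Frobenius polynomials matching after `∏_{w ∣ v} (·)(X^{f(w|v)})`).  See the
module docstring for the proof. [cite: ArthurClozel1989, Ch. 3 §6] [cite: Clifford1937, §§1–3] -/
theorem inducedPreAvatar_proof :
    Summit.Langlands.Langlands.Theses.CyclicDeinductionCarving.InducedPreAvatar := by
  intro K₀ _ _ K _ _ _ hGal hcyc hprime m n hK h₀ hm hn π P hπ hPalg hAI ℓ _ ι R hRss hR
  classical
  haveI := hGal
  haveI := hcyc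
  haveI : FiniteDimensional K₀ K := Module.Finite.of_restrictScalars_finite ℚ K₀ K
  haveI : IsAlgClosed (PadicAlgCl ℓ) := AlgebraicClosure.isAlgClosed _
  -- (0) a global choice of Satake parameters `β₀ w` of `π`
  have hβex : ∀ w : HeightOneSpectrum (𝓞 K), ∃ β : Multiset ℂ,
      π.1.IsUnramifiedAt w → π.1.HasSatakeParamAt w β := fun w => by
    by_cases h : π.1.IsUnramifiedAt w
    · obtain ⟨β, hβ⟩ := h
      exact ⟨β, fun _ => hβ⟩
    · exact ⟨∅, fun h' => absurd h' h⟩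
  choose β₀ hβ₀ using hβex
  have hπcof : ∀ᶠ w : HeightOneSpectrum (𝓞 K) in cofinite, π.1.IsUnramifiedAt w :=
    AutomorphicRepData.hasSatakeParamAt_cofinite_holds π.1
  have hπβ₀ : ∀ᶠ w : HeightOneSpectrum (𝓞 K) in cofinite, π.1.HasSatakeParamAt w (β₀ w) :=
    hπcof.mono fun w hw => hβ₀ w hw
  -- "a.e. `w`" → "a.e. `v`, every `w ∣ v`"
  have habove : ∀ᶠ v : HeightOneSpectrum (𝓞 K₀) in cofinite, ∀ w : HeightOneSpectrum (𝓞 K),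
      w.asIdeal.under (𝓞 K₀) = v.asIdeal → π.1.HasSatakeParamAt w (β₀ w) := by
    rw [Filter.eventually_cofinite] at hπβ₀ ⊢
    refine (hπβ₀.image fun w => w.under (𝓞 K₀)).subset fun v hv => ?_
    simp only [Set.mem_setOf_eq, not_forall] at hv
    obtain ⟨w, hw, hbad⟩ := hv
    exact ⟨w, hbad, HeightOneSpectrum.ext hw⟩
  -- the host-polynomial identity: `∏_{w ∣ v} G_w(X^{f(w|v)}) = arithFrobPolyOfSatake ι q_v 1 α`
  have hkey : ∀ (v : HeightOneSpectrum (𝓞 K₀)) (β : HeightOneSpectrum (𝓞 K) → Multiset ℂ)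
      (α : Multiset ℂ), satakePolynomial α =
        ∏ᶠ w ∈ {w : HeightOneSpectrum (𝓞 K) | w.asIdeal.under (𝓞 K₀) = v.asIdeal},
          (satakePolynomial (β w)).comp (X ^ w.asIdeal.inertiaDeg (𝓞 K₀)) →
      inducedFrobPolynomial v (fun w => arithFrobPolyOfSatake ι w.residueCard 1 (β w)) =
        arithFrobPolyOfSatake ι v.residueCard 1 α := by
    intro v β α hpoly
    have hβ1 : (fun w : HeightOneSpectrum (𝓞 K) => (β w).map (fun a => a * (1 : ℂ))) = β := by
      funext w
      rw [show (fun a : ℂ => a * 1) = id from funext fun a => mul_one a, Multiset.map_id]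
    have hB : satakePolynomial α =
        inducedSatakePolynomial v (fun w => (β w).map (fun a => a * (1 : ℂ))) := by
      rw [hβ1]
      exact hpoly
    have hhost := hostPoly_eq_arithFrobPolyOfSatake ι 1 β (fun _ => (1 : ℂ)) v α hB
    rw [← hhost, hostPoly, inducedFrobPolynomial, setOf_asIdeal_under_eq]
    refine finprod_mem_congr rfl fun w _ => ?_
    rw [Polynomial.expand_eq_comp_X_pow, congrFun hβ1 w]
  -- (1) at a.e. `v`: `R` is unramified with Frobenius polynomial `∏_{w ∣ v} G_w(X^{f(w|v)})`
  have hRgood : ∀ᶠ v : HeightOneSpectrum (𝓞 K₀) in cofinite, R.IsUnramifiedAt v ∧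
      R.HasFrobCharpolyAt v
        (inducedFrobPolynomial v (fun w => arithFrobPolyOfSatake ι w.residueCard 1 (β₀ w))) := by
    filter_upwards [hR, hAI, habove] with v hv₁ hv₂ hv₃
    obtain ⟨α', hPα', hur, hcp⟩ := hv₁
    obtain ⟨α, hPα, hpoly⟩ := hv₂ β₀ hv₃
    obtain rfl : α = α' := AutomorphicRepData.hasSatakeParamAt_unique_holds P.1 hPα hPα'
    refine ⟨hur, ?_⟩
    rw [hkey v β₀ α hpoly]
    exact hcp
  -- (2) the character `χ` of `Gal(K/K₀)` and the twist `R ⊗ χ`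
  obtain ⟨χ, hχres, hχ1⟩ := exists_layerCharacter K₀ K hprime (PadicAlgCl ℓ)
  set R' : FramedGaloisRep K₀ (PadicAlgCl ℓ) n := FramedRep.twist R χ with hR'def
  have hR'ss : R'.toGaloisRep.IsSemisimple := HarrisLanTaylorThorne2016.isSemisimple_twist hRss χ
  -- the inertia groups above a.e. `v` lie in `res(Γ_K)`
  have hI := eventually_forall_inertia_le_range_absGaloisRestrict K₀ K
  -- (3) `R` and `R ⊗ χ` have the same Frobenius data a.e.
  have hBN : ∀ᶠ v : HeightOneSpectrum (𝓞 K₀) in cofinite,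
      R.IsUnramifiedAt v ∧ R'.IsUnramifiedAt v ∧
        ∃ Q : (PadicAlgCl ℓ)[X], R.HasFrobCharpolyAt v Q ∧ R'.HasFrobCharpolyAt v Q := by
    filter_upwards [hRgood, hI] with v hv hIv
    obtain ⟨hur, hcp⟩ := hv
    have hχI : ∀ 𝔓 ∈ v.primesAbove, ∀ σ ∈ 𝔓.inertia (absoluteGaloisGroup K₀), χ σ = 1 := by
      intro 𝔓 h𝔓 σ hσ
      obtain ⟨τ, hτ⟩ := hIv 𝔓 h𝔓 hσ
      rw [← hτ]
      exact hχres τ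
    refine ⟨hur, FramedGaloisRep.isUnramifiedAt_twist hur hχI, _, hcp, ?_⟩
    intro 𝔓 h𝔓 σ hσ
    have hRσ := hcp 𝔓 h𝔓 σ hσ
    -- `χ(σ)^{f(w|v)} = 1` for every `w ∣ v`
    obtain ⟨𝔔, τ, s, -, hs, -, -, -⟩ := exists_frobenius_doubleCoset_data K₀ K h𝔓 hIv hσ
    have hχf : ∀ w ∈ {w : HeightOneSpectrum (𝓞 K) | w.asIdeal.under (𝓞 K₀) = v.asIdeal},
        (χ σ : PadicAlgCl ℓ) ^ w.asIdeal.inertiaDeg (𝓞 K₀) = 1 := by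
      intro w hw
      have h1 := congrArg χ (hs ⟨w, HeightOneSpectrum.ext hw⟩)
      rw [hχres, map_mul, map_mul, map_inv, map_pow, mul_right_comm, inv_mul_cancel, one_mul]
        at h1
      rw [← Units.val_pow_eq_pow_val, ← h1, Units.val_one]
    have hmonic : (inducedFrobPolynomial v
        (fun w => arithFrobPolyOfSatake ι w.residueCard 1 (β₀ w))).Monic := by
      rw [← hRσ]
      exact Matrix.charpoly_monic _
    have hcomp : (inducedFrobPolynomial v
        (fun w => arithFrobPolyOfSatake ι w.residueCard 1 (β₀ w))).comp (C (χ σ : PadicAlgCl ℓ) * X) =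
        inducedFrobPolynomial v (fun w => arithFrobPolyOfSatake ι w.residueCard 1 (β₀ w)) :=
      finprod_comp_X_pow_comp_C_mul_X
        (Literature.NumberTheory.Automorphic.finite_setOf_asIdeal_under_eq (E := K) v)
        (fun w => arithFrobPolyOfSatake ι w.residueCard 1 (β₀ w))
        (fun w => w.asIdeal.inertiaDeg (𝓞 K₀)) hχf
    have hcn : (χ σ : PadicAlgCl ℓ) ^ Fintype.card (Fin n) = 1 := by
      rw [← Matrix.charpoly_natDegree_eq_dim
        ((R σ : GL (Fin n) (PadicAlgCl ℓ)) : Matrix (Fin n) (Fin n) (PadicAlgCl ℓ))]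
      unfold FramedRep.charpoly at hRσ
      rw [hRσ]
      exact pow_natDegree_eq_one_of_comp_C_mul_X hmonic (Units.ne_zero _) hcomp
    unfold FramedRep.charpoly at hRσ ⊢
    rw [hR'def, FramedRep.coe_twist_apply]
    apply comp_C_mul_X_injective (isUnit_iff_ne_zero.mpr (Units.ne_zero (χ σ)))
    dsimp only
    rw [charpoly_smul_comp_C_mul_X, hcn, map_one, one_mul, hRσ, hcomp]
  obtain ⟨e⟩ := FramedGaloisRep.nonempty_equiv_of_hasFrobCharpolyAt_eventually
    chebotarev_artinRep_holds R R' hRss hR'ss hBN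
  obtain ⟨Pm, hPm⟩ := FramedRep.exists_eq_conj_of_equiv R R' e
  -- (4) de-induction: `R` has the characteristic polynomials of `Ind s`
  obtain ⟨m', s, hnm', hker, hchar⟩ :=
    FramedGaloisRep.exists_charpoly_eq_charpoly_induce_of_conj_eq_twist K₀ K hprime R χ hχres hχ1
      Pm hPm.symm
  -- (5) the rank `[K:K₀] · m = n`, read off from the Satake parameters at one good place
  have hunrK : ∀ᶠ v : HeightOneSpectrum (𝓞 K₀) in cofinite,
      Algebra.IsUnramifiedIn (𝓞 K) v.asIdeal :=
    Filter.eventually_cofinite.2 (finite_setOf_not_isUnramifiedIn K₀ K)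
  haveI : Infinite (HeightOneSpectrum (𝓞 K₀)) := SorensenPatching.infinite_heightOneSpectrum K₀
  obtain ⟨v₀, hv₀AI, hv₀β, hv₀unr⟩ := (hAI.and (habove.and hunrK)).exists
  have hdm : Module.finrank K₀ K * m = n := by
    obtain ⟨α, hPα, hpoly⟩ := hv₀AI β₀ hv₀β
    have hS := Literature.NumberTheory.Automorphic.finite_setOf_asIdeal_under_eq (E := K) v₀
    have h1 := congrArg Polynomial.natDegree hpoly
    rw [natDegree_satakePolynomial, hPα.card_eq] at h1
    change n = (inducedSatakePolynomial v₀ β₀).natDegree at h1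
    have h2 : ∑ᶠ w ∈ {w : HeightOneSpectrum (𝓞 K) | w.asIdeal.under (𝓞 K₀) = v₀.asIdeal},
        Multiset.card (β₀ w) * w.asIdeal.inertiaDeg (𝓞 K₀) =
        ∑ᶠ w ∈ {w : HeightOneSpectrum (𝓞 K) | w.asIdeal.under (𝓞 K₀) = v₀.asIdeal},
          m * w.asIdeal.inertiaDeg (𝓞 K₀) :=
      finsum_mem_congr rfl fun w hw => by rw [(hv₀β w hw).card_eq]
    rw [natDegree_inducedSatakePolynomial, h2, finsum_mem_eq_finite_toFinset_sum _ hS,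
      ← Finset.mul_sum, ← finsum_mem_eq_finite_toFinset_sum _ hS,
      finsum_inertiaDeg_eq_finrank v₀ hv₀unr] at h1
    rw [h1, mul_comm]
  have hm' : m' = m :=
    Nat.eq_of_mul_eq_mul_left hprime.pos (by rw [← hnm', ← hdm])
  subst hm'
  -- (6) the pre-avatar: the semisimplification of `s`
  obtain ⟨r, hrss, -, -, hur_r, hcp_r⟩ := FramedGaloisRep.exists_semisimplification s
  refine ⟨r, hrss, ?_⟩
  -- Frobenius polynomials of `s` at its unramified places
  have hQex : ∀ w : HeightOneSpectrum (𝓞 K), ∃ Q : (PadicAlgCl ℓ)[X],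
      s.IsUnramifiedAt w → s.HasFrobCharpolyAt w Q := fun w => by
    by_cases h : s.IsUnramifiedAt w
    · obtain ⟨Q, hQ⟩ := h.exists_hasFrobCharpolyAt
      exact ⟨Q, fun _ => hQ⟩
    · exact ⟨0, fun h' => absurd h' h⟩
  choose Q hQ using hQex
  filter_upwards [hRgood, hI, hAI, habove, hR] with v hv hIv hAIv hβv hRv
  intro β hβ
  obtain ⟨hur, hcp⟩ := hv
  -- `s` is unramified at every `w ∣ v` (it is trivial wherever `R|_{Γ_K}` is)
  have hsunr : ∀ w : HeightOneSpectrum (𝓞 K), w.asIdeal.under (𝓞 K₀) = v.asIdeal →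
      s.IsUnramifiedAt w := by
    intro w hw 𝔔 h𝔔 τ hτ
    have h1 := FramedGaloisRep.isUnramifiedAt_restrictField R hw hur 𝔔 h𝔔 τ hτ
    rw [FramedGaloisRep.restrictField_apply] at h1
    exact hker τ h1
  refine ⟨Q, fun w hw => ⟨hur_r w (hsunr w hw), hcp_r w _ (hQ w (hsunr w hw))⟩, ?_⟩
  -- the product identity
  obtain ⟨α', hPα', -, hcpR⟩ := hRv
  obtain ⟨α, hPα, hpoly⟩ := hAIv β hβ
  obtain rfl : α = α' := AutomorphicRepData.hasSatakeParamAt_unique_holds P.1 hPα hPα'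
  have hind : (s.induce K₀ rfl).HasFrobCharpolyAt v (inducedFrobPolynomial v Q) :=
    s.hasFrobCharpolyAt_induce K₀ rfl hIv fun w hw => hQ w (hsunr w hw)
  obtain ⟨𝔓, h𝔓⟩ := v.primesAbove_nonempty
  obtain ⟨g, hg⟩ := HeightOneSpectrum.exists_isArithFrobAt_of_mem_primesAbove_holds h𝔓
  have h1 : inducedFrobPolynomial v Q = FramedRep.charpoly (s.induce K₀ rfl) g :=
    (hind 𝔓 h𝔓 g hg).symm
  have h2 : FramedRep.charpoly R g = arithFrobPolyOfSatake ι v.residueCard 1 α := hcpR 𝔓 h𝔓 g hg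
  have h3 := hkey v β α hpoly
  change inducedFrobPolynomial v Q =
    inducedFrobPolynomial v (fun w => arithFrobPolyOfSatake ι w.residueCard 1 (β w))
  rw [h1, ← hchar g, h2, h3]

end Summit.Langlands.Langlands.Theorems

end
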